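import Literature.AlgebraicGeometry.Resolution.TaylorLift
import Mathlib.RingTheory.MvPolynomial.Homogeneous
import Mathlib.RingTheory.LocalRing.ResidueField.Basic
import Mathlib.Algebra.Order.Antidiag.Finsupp
import HarnessLib

/-!
# The unit order criterion for formally smooth coordinates

Topic: `Literature/AlgebraicGeometry/Resolution`. Let `O` be a LOCAL `K`-algebra whose maximal ideal is generated by
`x₁, …, xₙ`, and suppose a Taylor lift `τ : O → O[Y]/(Y)^{N+1}` (`τ(b)|_{Y=0} = b`, `τ(xᵢ) = xᵢ + Yᵢ`; file
`TaylorLift.lean`) with coefficient operators `D^{[β]}` is given — e.g. because `O` is formally smooth over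
`K[X₁,…,Xₙ]`, `Xᵢ ↦ xᵢ` (`TaylorLift.exists_taylorLift`). PROVED here:

* `taylor_remainder` — for `h ∈ 𝔪^d`, `d ≤ N`: `h ≡ Σ_{|β| = d} D^{[β]}(h) · x^β (mod 𝔪^{d+1})` (no locality needed:
  `𝔪` may be any ideal `(x₁,…,xₙ)`);
* `exists_isUnit_coeffOp` — an element `g ∈ 𝔪^m ∖ 𝔪^{m+1}`, `m ≤ N`, has a UNIT coefficient `D^{[β]}(g)`, `|β| = m`;
* **`diffIdeal_span_singleton_pow_eq_top_of_taylorLift`**, **`diffIdeal_span_singleton_pow_eq_top_of_formallySmooth`**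
  — the UNIT ORDER CRITERION: if `g ∈ 𝔪^m ∖ 𝔪^{m+1}` then for every `e` (with `em ≤ N`, resp. for formally smooth
  coordinates) `Diff^{≤ em}_{O/K}((g^e)) = O`: some `K`-linear differential operator of order `≤ em` (a coefficient
  operator `D^{[δ]}`, `|δ| = em`) takes `g^e` to a unit. Proof: reduce `τ` modulo `𝔪`; in `κ[Y]/(Y)^{N+1}` the image
  of `g` is `F + G` with `F ≠ 0` a form of degree `m` and `G ∈ (Y)^{m+1}`, so the image `(F+G)^e` of `g^e` has the
  non-zero degree-`em` part `F^e`, `κ[Y]` being a domain.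

This generalises the tree's model case at the origin of affine space (`TaylorUnitOrderCriterion.lean`,
`OriginLocalization.diffIdeal_span_singleton_pow_eq_top`: `O = k[x]_{(x)}`) to every local ring with formally smooth
coordinates — e.g. the local ring of a smooth variety over a perfect field at a CLOSED point, whose regular system of
parameters is a system of étale coordinates. Consumer: the Hironaka-2017 adjudication cell (typed clause
`Hironaka2017.S05NegativePart.U27L24`, «`Diff^{(md′−md)} g^{d′−d} = O_{Z,ξ}` by the assumption on `g`», p.27 l.24);
nothing about that manuscript is asserted here.

Sources: [EGAIV4] §16.8, Thm. 16.11.2; [Matsumura1987] §27–§28; [VillamayorU2008ReesDiff] §4.1, Remark 4.3.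
-/

noncomputable section

open MvPolynomial Finset IsLocalRing

namespace Literature.AlgebraicGeometry.Resolution

namespace TaylorLift

universe u v

variable {K : Type u} [CommRing K] {n : ℕ} {O : Type v} [CommRing O] [Algebra K O]

/-! ## Monomials in the coordinates and the powers of `(x₁,…,xₙ)` -/

open Hironaka2017.S03DiffARNE in
/-- `x^α ∈ (x)^{|α|}`. [cite: Matsumura1987, §27 (monomials in a system of parameters)] -/
theorem powOf_mem_pow (x : Fin n → O) (α : Fin n →₀ ℕ) :
    powOf x α ∈ Ideal.span (Set.range x) ^ α.degree := by
  rw [powOf, Finsupp.degree_eq_sum, ← Finset.prod_pow_eq_pow_sum]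
  exact Ideal.prod_mem_prod fun i _ => Ideal.pow_mem_pow (Ideal.subset_span (Set.mem_range_self i)) _

open Hironaka2017.S03DiffARNE in
/-- `(x)^d` is spanned by the monomials `x^α`, `|α| = d`. [cite: Matsumura1987, §27] -/
theorem span_range_pow_eq (x : Fin n → O) (d : ℕ) :
    Ideal.span (Set.range x) ^ d = Ideal.span (powOf x '' {α : Fin n →₀ ℕ | α.degree = d}) := by
  rw [Ideal.span, Submodule.span_pow, ← Set.image_univ, Finsupp.image_pow_eq_finsuppProd_image]
  refine congrArg _ (Set.ext fun b => ?_)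
  constructor
  · rintro ⟨v, ⟨hv, -⟩, rfl⟩
    exact ⟨v, hv, (Finsupp.prod_fintype v (fun a k => x a ^ k) fun a => pow_zero (x a)).symm⟩
  · rintro ⟨v, hv, rfl⟩
    exact ⟨v, ⟨hv, Set.subset_univ _⟩, Finsupp.prod_fintype v (fun a k => x a ^ k) fun a => pow_zero (x a)⟩

/-- Multi-indices: `β ≤ α` with `|β| = |α|` forces `β = α`. [folklore] -/
private theorem finsupp_eq_of_le_of_degree_eq {ι : Type*} {β α : ι →₀ ℕ} (hle : β ≤ α)
    (hdeg : β.degree = α.degree) : β = α := by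
  obtain ⟨γ, rfl⟩ := exists_add_of_le hle
  have hγ : γ.degree = 0 := by rw [map_add] at hdeg; omega
  rw [Finsupp.degree_eq_zero_iff] at hγ
  rw [hγ, add_zero]

/-- Membership in `univ.finsuppAntidiag d` is `|β| = d`. [folklore] -/
private theorem mem_finsuppAntidiag_univ_iff {d : ℕ} {β : Fin n →₀ ℕ} :
    β ∈ (Finset.univ : Finset (Fin n)).finsuppAntidiag d ↔ β.degree = d := by
  rw [Finset.mem_finsuppAntidiag, Finsupp.degree_eq_sum]
  simp

/-! ## The Taylor formula modulo `(x)^{d+1}` and the unit coefficient -/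

section Lift

variable {N : ℕ} {x : Fin n → O} {τ : O →ₐ[K] (MvPolynomial (Fin n) O ⧸ (idealOfVars (Fin n) O) ^ (N + 1))}
  {D : (Fin n →₀ ℕ) → (O →ₗ[K] O)}

open Hironaka2017.S03DiffARNE in
/-- **Truncated Taylor formula modulo `(x)^{d+1}`**: for `h ∈ (x)^d`, `d ≤ N`,
`h ≡ Σ_{|β| = d} D^{[β]}(h) · x^β (mod (x)^{d+1})` (induction over the monomials spanning `(x)^d`, by the Leibniz
rule, `D^{[0]} = id`, the values `D^{[β]}(x^α) = δ_{αβ}` for `|α| = |β|`, and the order-lowering bound for `D^{[δ]}`).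
[cite: Matsumura1987, §27–§28 (Taylor expansion through higher derivations)] -/
theorem taylor_remainder
    (hev : ∀ (b : O) (p : MvPolynomial (Fin n) O), Ideal.Quotient.mk _ p = τ b →
      MvPolynomial.aeval (fun _ : Fin n => (0 : O)) p = b)
    (hco : ∀ i : Fin n, τ (x i) = Ideal.Quotient.mk _ (C (x i) + X i))
    (hD : ∀ β : Fin n →₀ ℕ, β.degree ≤ N → ∀ (b : O) (p : MvPolynomial (Fin n) O),
      Ideal.Quotient.mk _ p = τ b → D β b = coeff β p)
    {d : ℕ} (hd : d ≤ N) {b : O} (hb : b ∈ Ideal.span (Set.range x) ^ d) :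
    b - ∑ β ∈ (Finset.univ : Finset (Fin n)).finsuppAntidiag d, D β b * powOf x β ∈
      Ideal.span (Set.range x) ^ (d + 1) := by
  set I := Ideal.span (Set.range x) with hI
  set S := (Finset.univ : Finset (Fin n)).finsuppAntidiag d with hS
  have hSdeg : ∀ β ∈ S, β.degree = d := fun β hβ => mem_finsuppAntidiag_univ_iff.mp hβ
  rw [span_range_pow_eq x d] at hb
  refine Submodule.span_induction (p := fun b _ => b - ∑ β ∈ S, D β b * powOf x β ∈ I ^ (d + 1))
    ?_ ?_ ?_ ?_ hb
  · -- monomials `x^α`, `|α| = d`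
    rintro _ ⟨α, hα, rfl⟩
    have hα' : α ∈ S := mem_finsuppAntidiag_univ_iff.mpr hα
    have hsum : ∑ β ∈ S, D β (powOf x α) * powOf x β = powOf x α := by
      rw [Finset.sum_eq_single α]
      · rw [coeffOp_powOf hco hD (by rw [hα]; exact hd), eq8Rhs_self, one_mul]
      · intro β hβ hne
        rw [coeffOp_powOf hco hD (by rw [hSdeg β hβ]; exact hd), eq8Rhs_of_not_le, zero_mul]
        intro hle
        exact hne (finsupp_eq_of_le_of_degree_eq hle (by rw [hSdeg β hβ, hα]))
      · intro hα''
        exact absurd hα' hα''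
    rw [hsum, sub_self]
    exact Submodule.zero_mem _
  · simp
  · intro a c _ _ ha hc
    have e : a + c - ∑ β ∈ S, D β (a + c) * powOf x β =
        (a - ∑ β ∈ S, D β a * powOf x β) + (c - ∑ β ∈ S, D β c * powOf x β) := by
      simp only [map_add, add_mul, Finset.sum_add_distrib]
      ring
    rw [e]
    exact Ideal.add_mem _ ha hc
  · intro c a ha hpa
    have ha' : a ∈ I ^ d := by rw [hI, span_range_pow_eq x d]; exact ha
    -- the correction terms of the Leibniz rule
    let E : (Fin n →₀ ℕ) → O := fun β =>
      ∑ q ∈ (Finset.antidiagonal β).erase (0, β), D q.1 c * D q.2 a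
    have key : ∀ β ∈ S, D β (c * a) = c * D β a + E β := by
      intro β hβ
      have h0 : ((0 : Fin n →₀ ℕ), β) ∈ Finset.antidiagonal β := by simp
      rw [coeffOp_mul hD (by rw [hSdeg β hβ]; exact hd), ← Finset.add_sum_erase _ _ h0,
        coeffOp_zero_apply hev hD]
    have hsum : ∑ β ∈ S, D β (c * a) * powOf x β =
        c * ∑ β ∈ S, D β a * powOf x β + ∑ β ∈ S, E β * powOf x β := by
      rw [Finset.mul_sum, ← Finset.sum_add_distrib]
      refine Finset.sum_congr rfl fun β hβ => ?_
      rw [key β hβ]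
      ring
    have e : c • a - ∑ β ∈ S, D β (c * a) * powOf x β =
        c * (a - ∑ β ∈ S, D β a * powOf x β) - ∑ β ∈ S, E β * powOf x β := by
      rw [hsum, smul_eq_mul]
      ring
    rw [smul_eq_mul] at e ⊢
    rw [e]
    refine Ideal.sub_mem _ (Ideal.mul_mem_left _ c hpa) (Ideal.sum_mem _ fun β hβ => ?_)
    rw [Finset.sum_mul]
    refine Ideal.sum_mem _ fun q hq => ?_
    obtain ⟨hne, hq'⟩ := Finset.mem_erase.mp hq
    rw [Finset.mem_antidiagonal] at hq'
    have h1 : q.1 ≠ 0 := by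
      intro h1
      apply hne
      rw [h1, zero_add] at hq'
      exact Prod.ext h1 hq'
    have hdeg : q.1.degree + q.2.degree = d := by rw [← map_add, hq', hSdeg β hβ]
    have h1' : 1 ≤ q.1.degree := by
      rw [Nat.one_le_iff_ne_zero, Ne, Finsupp.degree_eq_zero_iff]; exact h1
    -- `D^{[q.2]}(a) ∈ I` since `|q.2| < d`
    have h2 : D q.2 a ∈ I := by
      have := coeffOp_apply_mem_pow_sub hev hD I (by omega : q.2.degree ≤ N) ha'
      exact Ideal.pow_le_self (by omega) this
    have h3 : powOf x β ∈ I ^ d := by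
      have := powOf_mem_pow x β
      rwa [hSdeg β hβ] at this
    rw [pow_succ']
    exact Ideal.mul_mem_mul (Ideal.mul_mem_left _ _ h2) h3

open Hironaka2017.S03DiffARNE in
/-- **An element of exact order `m` has a unit Taylor coefficient of degree `m`** (local ring with
`𝔪 = (x₁,…,xₙ)`, `m ≤ N`): if `g ∈ 𝔪^m ∖ 𝔪^{m+1}` then `D^{[β]}(g)` is a unit for some `|β| = m`.
[cite: Matsumura1987, §27–§28] -/
theorem exists_isUnit_coeffOp [IsLocalRing O]
    (hev : ∀ (b : O) (p : MvPolynomial (Fin n) O), Ideal.Quotient.mk _ p = τ b →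
      MvPolynomial.aeval (fun _ : Fin n => (0 : O)) p = b)
    (hco : ∀ i : Fin n, τ (x i) = Ideal.Quotient.mk _ (C (x i) + X i))
    (hD : ∀ β : Fin n →₀ ℕ, β.degree ≤ N → ∀ (b : O) (p : MvPolynomial (Fin n) O),
      Ideal.Quotient.mk _ p = τ b → D β b = coeff β p)
    (hx : Ideal.span (Set.range x) = maximalIdeal O) {m : ℕ} (hm : m ≤ N) {g : O}
    (hg1 : g ∈ maximalIdeal O ^ m) (hg2 : g ∉ maximalIdeal O ^ (m + 1)) :
    ∃ β : Fin n →₀ ℕ, β.degree = m ∧ IsUnit (D β g) := by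
  by_contra hne
  simp only [not_exists, not_and] at hne
  apply hg2
  rw [← hx] at hg1 ⊢
  have hrem := taylor_remainder hev hco hD hm hg1
  have hsum : ∑ β ∈ (Finset.univ : Finset (Fin n)).finsuppAntidiag m, D β g * powOf x β ∈
      Ideal.span (Set.range x) ^ (m + 1) := by
    refine Ideal.sum_mem _ fun β hβ => ?_
    have hβd : β.degree = m := mem_finsuppAntidiag_univ_iff.mp hβ
    have h1 : D β g ∈ Ideal.span (Set.range x) := by
      rw [hx]
      exact (IsLocalRing.mem_maximalIdeal _).mpr (hne β hβd)
    have h2 : powOf x β ∈ Ideal.span (Set.range x) ^ m := by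
      have := powOf_mem_pow x β
      rwa [hβd] at this
    rw [pow_succ']
    exact Ideal.mul_mem_mul h1 h2
  have := Ideal.add_mem _ hrem hsum
  rwa [sub_add_cancel] at this

/-- **Unit order criterion along a Taylor lift.** Let `O` be local with `𝔪 = (x₁,…,xₙ)`, `τ` a Taylor lift of
order `N` for `x` with coefficient operators `D`. If `g ∈ 𝔪^m ∖ 𝔪^{m+1}` and `em ≤ N`, then
`Diff^{≤ em}_{O/K}((g^e)) = O`: the coefficient operator `D^{[δ]}` for a suitable `|δ| = em` is a differential
operator of order `≤ em` taking `g^e` to a unit. (Reduce `τ` modulo `𝔪`: in `κ[Y]/(Y)^{N+1}` the image of `g` is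
`F + G` with `F ≠ 0` a form of degree `m` and `G ∈ (Y)^{m+1}`; the image of `g^e` is `(F+G)^e ≡ F^e`
modulo `(Y)^{em+1}`, and `F^e ≠ 0` since `κ[Y]` is a domain.)
[cite: VillamayorU2008ReesDiff, §4.1 and Remark 4.3] [cite: EGAIV4, Thm. 16.11.2] -/
theorem diffIdeal_span_singleton_pow_eq_top_of_taylorLift [IsLocalRing O]
    (hev : ∀ (b : O) (p : MvPolynomial (Fin n) O), Ideal.Quotient.mk _ p = τ b →
      MvPolynomial.aeval (fun _ : Fin n => (0 : O)) p = b)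
    (hco : ∀ i : Fin n, τ (x i) = Ideal.Quotient.mk _ (C (x i) + X i))
    (hD : ∀ β : Fin n →₀ ℕ, β.degree ≤ N → ∀ (b : O) (p : MvPolynomial (Fin n) O),
      Ideal.Quotient.mk _ p = τ b → D β b = coeff β p)
    (hx : Ideal.span (Set.range x) = maximalIdeal O) {m : ℕ} {g : O}
    (hg1 : g ∈ maximalIdeal O ^ m) (hg2 : g ∉ maximalIdeal O ^ (m + 1)) {e : ℕ} (he : e * m ≤ N) :
    diffIdeal K (e * m) (Ideal.span {g ^ e}) = ⊤ := by
  classical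
  rcases Nat.eq_zero_or_pos e with rfl | he0
  · rw [pow_zero, Ideal.span_singleton_one]
    exact top_le_iff.mp (le_diffIdeal K _ _)
  have hmN : m ≤ N := le_trans (Nat.le_mul_of_pos_left m he0) he
  set κ := ResidueField O with hκ
  set J : Ideal (MvPolynomial (Fin n) κ) := idealOfVars (Fin n) κ with hJ
  -- the reduction `O → κ[Y]/(Y)^{N+1}` of `τ`
  have hle : (idealOfVars (Fin n) O) ^ (N + 1) ≤ (J ^ (N + 1)).comap (MvPolynomial.map (residue O)) := by
    rw [← Ideal.map_le_iff_le_comap, Ideal.map_pow]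
    refine Ideal.pow_right_mono ?_ _
    rw [Ideal.map_span, Ideal.span_le]
    rintro _ ⟨_, ⟨i, rfl⟩, rfl⟩
    rw [MvPolynomial.map_X]
    exact Ideal.subset_span ⟨i, rfl⟩
  let ρ : O →+* MvPolynomial (Fin n) κ ⧸ J ^ (N + 1) :=
    (Ideal.quotientMap (J ^ (N + 1)) (MvPolynomial.map (residue O)) hle).comp τ.toRingHom
  have hρ : ∀ (b : O) (p : MvPolynomial (Fin n) O), Ideal.Quotient.mk _ p = τ b →
      ρ b = Ideal.Quotient.mk _ (MvPolynomial.map (residue O) p) := by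
    intro b p hp
    change Ideal.quotientMap _ _ hle (τ b) = _
    rw [← hp, Ideal.quotientMap_mk]
  -- representatives of `τ g` and `τ (g^e)`
  obtain ⟨p, hp⟩ := Ideal.Quotient.mk_surjective (τ g)
  obtain ⟨pe, hpe⟩ := Ideal.Quotient.mk_surjective (τ (g ^ e))
  set pb := MvPolynomial.map (residue O) p with hpb
  have hcong : Ideal.Quotient.mk (J ^ (N + 1)) (MvPolynomial.map (residue O) pe) =
      Ideal.Quotient.mk _ (pb ^ e) := by
    rw [← hρ _ _ hpe, map_pow ρ, hρ _ _ hp, map_pow]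
  -- the coefficients of `pb` below degree `m` vanish, one of degree `m` does not
  have hlow : ∀ δ : Fin n →₀ ℕ, δ.degree < m → coeff δ pb = 0 := by
    intro δ hδ
    rw [hpb, coeff_map, ← hD δ (by omega) g p hp, residue_eq_zero_iff]
    exact Ideal.pow_le_self (by omega)
      (coeffOp_apply_mem_pow_sub hev hD (maximalIdeal O) (by omega : δ.degree ≤ N) hg1)
  obtain ⟨β₀, hβ₀, hunit⟩ := exists_isUnit_coeffOp hev hco hD hx hmN hg1 hg2
  set F := homogeneousComponent m pb with hF
  have hFh : F.IsHomogeneous m := homogeneousComponent_isHomogeneous m pb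
  have hFne : F ≠ 0 := by
    intro hF0
    have hc := coeff_homogeneousComponent m pb β₀
    rw [← hF, hF0, coeff_zero, if_pos hβ₀] at hc
    have hc' : coeff β₀ pb ≠ 0 := by
      rw [hpb, coeff_map, ← hD β₀ (by omega) g p hp]
      exact (residue_ne_zero_iff_isUnit _).mpr hunit
    exact hc' hc.symm
  have hFmem : F ∈ J ^ m := by
    rw [hJ, mem_pow_idealOfVars_iff']
    intro δ hδ
    exact hFh.coeff_eq_zero (by omega)
  have hGmem : pb - F ∈ J ^ (m + 1) := by
    rw [hJ, mem_pow_idealOfVars_iff']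
    intro δ hδ
    rw [coeff_sub, hF, coeff_homogeneousComponent]
    by_cases hδm : δ.degree = m
    · rw [if_pos hδm, sub_self]
    · rw [if_neg hδm, sub_zero]
      exact hlow δ (by omega)
  -- `pb^e - F^e ∈ J^{em+1}`
  have hR : pb ^ e - F ^ e ∈ J ^ (e * m + 1) := by
    have hexp := add_pow F (pb - F) e
    have hs : F + (pb - F) = pb := by ring
    rw [hs, Finset.sum_range_succ, Nat.sub_self, pow_zero, mul_one, Nat.choose_self, Nat.cast_one,
      mul_one] at hexp
    have e1 : pb ^ e - F ^ e =
        ∑ k ∈ Finset.range e, F ^ k * (pb - F) ^ (e - k) * (e.choose k : MvPolynomial (Fin n) κ) := by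
      rw [hexp]; ring
    rw [e1]
    refine Ideal.sum_mem _ fun j hj => ?_
    have hj' : j < e := Finset.mem_range.mp hj
    have h1 : F ^ j ∈ J ^ (m * j) := by rw [pow_mul]; exact Ideal.pow_mem_pow hFmem j
    have h2 : (pb - F) ^ (e - j) ∈ J ^ ((m + 1) * (e - j)) := by
      rw [pow_mul]; exact Ideal.pow_mem_pow hGmem _
    have h12 : F ^ j * (pb - F) ^ (e - j) ∈ J ^ (m * j + (m + 1) * (e - j)) := by
      rw [pow_add]; exact Ideal.mul_mem_mul h1 h2
    have hle' : e * m + 1 ≤ m * j + (m + 1) * (e - j) := by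
      obtain ⟨k, rfl⟩ := Nat.exists_eq_add_of_lt hj'
      rw [show j + k + 1 - j = k + 1 by omega]
      nlinarith
    exact Ideal.mul_mem_right _ _ (Ideal.pow_le_pow_right hle' h12)
  -- a non-zero coefficient of degree `em`
  have hFe : (F ^ e).IsHomogeneous (m * e) := hFh.pow e
  obtain ⟨δ, hδ⟩ := MvPolynomial.ne_zero_iff.mp (pow_ne_zero e hFne)
  have hδdeg : δ.degree = e * m := by
    by_contra hne
    exact hδ (hFe.coeff_eq_zero (by rw [Nat.mul_comm]; exact hne))
  have hcoeff : coeff δ (pb ^ e) ≠ 0 := by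
    have h0 : coeff δ (pb ^ e - F ^ e) = 0 :=
      (mem_pow_idealOfVars_iff' _ _).mp hR δ (by omega)
    rw [coeff_sub, sub_eq_zero] at h0
    rwa [h0]
  have hcoeff' : coeff δ (MvPolynomial.map (residue O) pe) ≠ 0 := by
    rwa [coeff_eq_of_mk_eq hcong (by omega)]
  -- hence `D^{[δ]}(g^e)` is a unit, and it lies in `Diff^{≤ em}((g^e))`
  rw [coeff_map, ← hD δ (by omega) (g ^ e) pe hpe, residue_ne_zero_iff_isUnit] at hcoeff'
  have hDop : IsDiffOpLE K (e * m) (D δ) := isDiffOpLE_coeffOp hev hD (e * m) δ hδdeg.le he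
  exact Ideal.eq_top_of_isUnit_mem _ (apply_mem_diffIdeal K hDop (Ideal.mem_span_singleton_self _)) hcoeff'

end Lift

/-- **Unit order criterion for formally smooth coordinates** (self-contained form). Let `O` be a local
`K`-algebra and `x₁,…,xₙ` generators of `𝔪_O` such that `O` is formally smooth over `K[X₁,…,Xₙ]`, `Xᵢ ↦ xᵢ` —
for instance the local ring of a smooth variety over a perfect field at a closed point with a regular system of
parameters. If `g ∈ 𝔪^m ∖ 𝔪^{m+1}` then for every `e`, `Diff^{≤ em}_{O/K}((g^e)) = O`: some differential operator of
order `≤ em` takes `g^e` to a unit. [cite: VillamayorU2008ReesDiff, §4.1 and Remark 4.3] [cite: EGAIV4, Thm. 16.11.2] -/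
theorem diffIdeal_span_singleton_pow_eq_top_of_formallySmooth [IsLocalRing O] (x : Fin n → O)
    (hO : letI := (MvPolynomial.aeval x : MvPolynomial (Fin n) K →ₐ[K] O).toRingHom.toAlgebra
      Algebra.FormallySmooth (MvPolynomial (Fin n) K) O)
    (hx : Ideal.span (Set.range x) = maximalIdeal O) {m : ℕ} {g : O}
    (hg1 : g ∈ maximalIdeal O ^ m) (hg2 : g ∉ maximalIdeal O ^ (m + 1)) (e : ℕ) :
    diffIdeal K (e * m) (Ideal.span {g ^ e}) = ⊤ := by
  obtain ⟨τ, hev, hco⟩ := exists_taylorLift K n O x hO (e * m)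
  obtain ⟨D, hD⟩ := exists_coeffOps K τ
  exact diffIdeal_span_singleton_pow_eq_top_of_taylorLift hev hco hD hx hg1 hg2 le_rfl

end TaylorLift

end Literature.AlgebraicGeometry.Resolution

end
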